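import Literature.InformationTheory.QuantumCodes.TwistedToricCodes
import HarnessLib

/-!
# Toric codes on twisted tori — walks on the Cayley graph, their chains, net displacement, staircases

Topic `InformationTheory/QuantumCodes`; namespace `Literature.InformationTheory.QuantumCodes.TwistedToric`.
LADDER-QEC (cell `qec`), PARTITION row 08, item 08.TWIST (file 2 of the distance proof of `TwistedToricCodes.lean`).

Combinatorics of lattice walks used on BOTH levels of the covering `ℤ² → G` (everything here is stated for an
arbitrary additive group `V` with two elements `g₁, g₂`; downstairs `V = G`, upstairs `V = ℤ × ℤ` with
`g₁ = (1,0)`, `g₂ = (0,1)`):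

* `Step` — the four unit steps `±g₁, ±g₂` (`hp, hm, vp, vm`); `Step.disp` its displacement in `ℤ²`, `Step.move`
  the vertex map, `Step.edge` the edge of `V ⊕ V` traversed (`hp` at `v` uses `inl v : v → v+g₁`, `hm` at `v`
  uses `inl (v − g₁)`, …);
* a walk = start vertex + `List Step`; `endPos`, net displacement `ndisp ∈ ℤ²` (`endPos = v + rel (ndisp w)`, so a
  walk is closed iff its net displacement is a PERIOD, `closed_iff_isPeriod`), and its `𝔽₂`-chain `wchain`
  (edges traversed, counted mod 2); `wchain_append`;
* **the boundary of a walk is its two endpoints**: `star (wchain v w) = vtx v + vtx (endPos v w)`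
  (`star_wchain`) — so closed walks are cycles (Dennis–Kitaev–Landahl–Preskill §3.1: an error chain `E` with
  endpoints; a cycle has no boundary);
* `l1 (ndisp w) ≤ length w` (`l1_ndisp_le_length`: a walk is at least as long as the L¹ norm of its net
  displacement — the metric half of the distance lower bound) and `hammingNorm (wchain v w) ≤ length w`;
* the **staircase** `stair m` (`|m₁|` horizontal then `|m₂|` vertical unit steps): `ndisp (stair m) = m`,
  `length (stair m) = l1 m` — the explicit shortest logical of the upper bound.

All definitions are computable plumbing (lists and group operations); 0 named facts, no instances, no notation.

## References
* [DennisEtAl2002] Dennis–Kitaev–Landahl–Preskill, *Topological quantum memory*, J. Math. Phys. 43 (2002),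
  §3.1 (chains, boundaries, cycles, homologically (non)trivial cycles on the torus; held chunk p0008 L1-5).
* [KovalevPryadko2012] Kovalev–Pryadko, arXiv:1202.0928, §III.C (p0005 L53-80: the period lattice and
  `d = min ‖m₁L₁ + m₂L₂‖`).
-/

namespace Literature.InformationTheory.QuantumCodes

open Matrix Finset

namespace TwistedToric

/-! ## Steps -/

/-- The four unit steps of a lattice walk: `hp = +g₁`, `hm = −g₁`, `vp = +g₂`, `vm = −g₂`. (definition)
[cite: DennisEtAl2002, §3.1 (links of the square lattice in the two directions)] -/
inductive Step
  | hp
  | hm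
  | vp
  | vm

namespace Step

/-- The displacement of a step in `ℤ²`: `(±1, 0)` or `(0, ±1)`. (definition) [cite: KovalevPryadko2012, §III.C (p0005 L53-56: lattice translations)] -/
def disp : Step → ℤ × ℤ
  | hp => (1, 0)
  | hm => (-1, 0)
  | vp => (0, 1)
  | vm => (0, -1)

/-- Every unit step has L¹ length `1`. [cite: KovalevPryadko2012, §III.C (p0005 L56: the norm ‖·‖₁)] -/
theorem l1_disp (s : Step) : l1 s.disp = 1 := by
  cases s <;> rfl

variable {V : Type*} [AddCommGroup V]

/-- The vertex reached by taking step `s` at `v`. (definition) [cite: DennisEtAl2002, §3.1 (links join neighbouring sites)] -/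
def move (g₁ g₂ : V) : Step → V → V
  | hp, v => v + g₁
  | hm, v => v - g₁
  | vp, v => v + g₂
  | vm, v => v - g₂

/-- The edge of `V ⊕ V` traversed by step `s` at `v`: the horizontal edge `inl j` joins `j → j + g₁`, the vertical
edge `inr j` joins `j → j + g₂`; backward steps use the edge ending at `v`. (definition)
[cite: DennisEtAl2002, §3.1 (links of the lattice; an error chain is a set of links)] -/
def edge (g₁ g₂ : V) : Step → V → V ⊕ V
  | hp, v => .inl v
  | hm, v => .inl (v - g₁)
  | vp, v => .inr v
  | vm, v => .inr (v - g₂)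

/-- `move` is translation by the image of the step's displacement: `s.move v = v + rel (s.disp)`.
[cite: KovalevPryadko2012, §III.C (p0005 L53-56: the covering map m ↦ m₁L₁ + m₂L₂)] -/
theorem move_eq_add_rel (g₁ g₂ : V) (s : Step) (v : V) : s.move g₁ g₂ v = v + rel g₁ g₂ s.disp := by
  cases s <;> simp [move, disp, rel_apply, sub_eq_add_neg]

end Step

/-! ## Walks: end point, net displacement, chain -/

section Walks

variable {V : Type*} [AddCommGroup V]

/-- The end vertex of the walk with steps `w` started at `v`. (definition) [cite: DennisEtAl2002, §3.1 (an open chain has two endpoints)] -/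
def endPos (g₁ g₂ : V) : V → List Step → V
  | v, [] => v
  | v, s :: t => endPos g₁ g₂ (s.move g₁ g₂ v) t

/-- The net displacement of a step list in `ℤ²` (sum of the step displacements). (definition)
[cite: KovalevPryadko2012, §III.C (p0005 L53-56: displacement vectors m₁L₁ + m₂L₂ in the covering lattice)] -/
def ndisp : List Step → ℤ × ℤ
  | [] => 0
  | s :: t => s.disp + ndisp t

/-- **End point = start + image of the net displacement.** [cite: KovalevPryadko2012, §III.C (p0005 L53-56: points connected by a lattice vector are identified on the torus)] -/
theorem endPos_eq (g₁ g₂ : V) (v : V) (w : List Step) : endPos g₁ g₂ v w = v + rel g₁ g₂ (ndisp w) := by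
  induction w generalizing v with
  | nil => simp [endPos, ndisp]
  | cons s t ih => rw [endPos, ih, ndisp, map_add, Step.move_eq_add_rel, add_assoc]

/-- `endPos` of a concatenation. [cite: DennisEtAl2002, §3.1 (composing chains)] -/
theorem endPos_append (g₁ g₂ : V) (v : V) (w w' : List Step) :
    endPos g₁ g₂ v (w ++ w') = endPos g₁ g₂ (endPos g₁ g₂ v w) w' := by
  induction w generalizing v with
  | nil => rfl
  | cons s t ih => exact ih _

/-- `ndisp` of a concatenation is the sum. [cite: KovalevPryadko2012, §III.C (p0005 L53-56: lattice vectors add)] -/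
theorem ndisp_append (w w' : List Step) : ndisp (w ++ w') = ndisp w + ndisp w' := by
  induction w with
  | nil => simp [ndisp]
  | cons s t ih => rw [List.cons_append, ndisp, ndisp, ih, add_assoc]

/-- **A walk is closed iff its net displacement is a period** of `(V; g₁, g₂)`.
[cite: KovalevPryadko2012, §III.C (p0005 L53-56: a path closes on the torus iff its displacement is m₁L₁ + m₂L₂)] -/
theorem closed_iff_isPeriod (g₁ g₂ : V) (v : V) (w : List Step) :
    endPos g₁ g₂ v w = v ↔ IsPeriod g₁ g₂ (ndisp w) := by
  rw [endPos_eq, isPeriod_iff_rel, add_eq_left]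

/-- **The L¹ norm of the net displacement is at most the number of steps.**
[cite: KovalevPryadko2012, §III.C (p0005 L72-76: the shortest non-trivial chain realising a period L has ‖L‖ operators)] -/
theorem l1_ndisp_le_length (w : List Step) : l1 (ndisp w) ≤ w.length := by
  induction w with
  | nil => simp [ndisp, l1]
  | cons s t ih =>
    rw [ndisp, List.length_cons]
    have := l1_add_le s.disp (ndisp t)
    rw [Step.l1_disp] at this
    omega

variable [DecidableEq V]

/-- The `𝔽₂`-chain of a walk: the edges traversed, counted modulo `2`. (definition)
[cite: DennisEtAl2002, §3.1 (an error chain E as a set of links with ℤ₂ coefficients)] -/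
def wchain (g₁ g₂ : V) : V → List Step → (V ⊕ V → ZMod 2)
  | _, [] => 0
  | v, s :: t => Pi.single (s.edge g₁ g₂ v) 1 + wchain g₁ g₂ (s.move g₁ g₂ v) t

/-- `wchain v [] = 0`. [cite: DennisEtAl2002, §3.1 (the empty chain)] -/
@[simp] theorem wchain_nil (g₁ g₂ : V) (v : V) : wchain g₁ g₂ v [] = 0 := rfl

/-- `wchain v (s :: t) = [edge of s at v] + wchain (s.move v) t`. [cite: DennisEtAl2002, §3.1 (chains add link by link)] -/
@[simp] theorem wchain_cons (g₁ g₂ : V) (v : V) (s : Step) (t : List Step) :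
    wchain g₁ g₂ v (s :: t) = Pi.single (s.edge g₁ g₂ v) 1 + wchain g₁ g₂ (s.move g₁ g₂ v) t := rfl

/-- The chain of a concatenation is the sum of the chains. [cite: DennisEtAl2002, §3.1 (E + E' for chains with ℤ₂ coefficients)] -/
theorem wchain_append (g₁ g₂ : V) (v : V) (w w' : List Step) :
    wchain g₁ g₂ v (w ++ w') = wchain g₁ g₂ v w + wchain g₁ g₂ (endPos g₁ g₂ v w) w' := by
  induction w generalizing v with
  | nil => simp [endPos]
  | cons s t ih => rw [List.cons_append, wchain_cons, wchain_cons, ih, endPos, add_assoc]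

/-- The star sum of the single edge of a step: `1` exactly at the step's two endpoints `v`, `s.move v`.
[cite: DennisEtAl2002, §3.1 (the boundary of a link is its two endpoint sites)] -/
theorem star_edge (g₁ g₂ : V) (s : Step) (v i : V) :
    star g₁ g₂ (Pi.single (s.edge g₁ g₂ v) 1) i = vtx v i + vtx (s.move g₁ g₂ v) i := by
  cases s with
  | hp => exact star_single_inl g₁ g₂ v i
  | hm =>
    rw [Step.edge, Step.move, star_single_inl, sub_add_cancel, add_comm]
  | vp => exact star_single_inr g₁ g₂ v i
  | vm =>
    rw [Step.edge, Step.move, star_single_inr, sub_add_cancel, add_comm]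

/-- **The boundary of a walk is (start) + (end)**: `star (wchain v w) = vtx v + vtx (endPos v w)` pointwise. In
particular a closed walk is a cycle (zero star sum everywhere).
[cite: DennisEtAl2002, §3.1 (chunk p0008 L1-3: the boundary of an error chain is the set of its endpoints — the syndrome; a cycle has no boundary)] -/
theorem star_wchain (g₁ g₂ : V) (v : V) (w : List Step) (i : V) :
    star g₁ g₂ (wchain g₁ g₂ v w) i = vtx v i + vtx (endPos g₁ g₂ v w) i := by
  induction w generalizing v with
  | nil => rw [wchain_nil, star_zero, endPos, CharTwo.add_self_eq_zero]
  | cons s t ih =>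
    rw [wchain_cons, star_add, star_edge, ih, endPos]
    rw [add_assoc, ← add_assoc (vtx (s.move g₁ g₂ v) i), CharTwo.add_self_eq_zero, zero_add]

/-- A closed walk's chain is a cycle: zero star sum at every vertex.
[cite: DennisEtAl2002, §3.1 (a closed chain is a cycle: it commutes with every star operator)] -/
theorem star_wchain_of_closed (g₁ g₂ : V) {v : V} {w : List Step} (h : endPos g₁ g₂ v w = v) (i : V) :
    star g₁ g₂ (wchain g₁ g₂ v w) i = 0 := by
  rw [star_wchain, h, CharTwo.add_self_eq_zero]

/-- Subadditivity of the Hamming weight over `𝔽₂` (private copy of the tree's `hammingNorm_add_le_add`). [folklore] -/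
private theorem hammingNorm_add_le' {α : Type*} [Fintype α] [DecidableEq α] (x y : α → ZMod 2) :
    hammingNorm (x + y) ≤ hammingNorm x + hammingNorm y := by
  have h := hammingDist_triangle (x + y) y 0
  have e : -(x + y) + y = x := by
    funext a
    simp only [Pi.add_apply, Pi.neg_apply, CharTwo.neg_eq]
    rw [add_assoc, CharTwo.add_self_eq_zero, add_zero]
  rw [hammingDist_zero_right, hammingDist_zero_right, hammingDist_eq_hammingNorm, e] at h
  exact h

/-- A single edge has Hamming weight at most `1`. [folklore] -/
private theorem hammingNorm_single_le_one {α : Type*} [Fintype α] [DecidableEq α] (a : α) :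
    hammingNorm (Pi.single a (1 : ZMod 2) : α → ZMod 2) ≤ 1 := by
  unfold hammingNorm
  refine Finset.card_le_one.2 ?_
  intro x hx y hy
  simp only [Finset.mem_filter, Finset.mem_univ, true_and, Pi.single_apply, ne_eq, ite_eq_right_iff,
    one_ne_zero, imp_false, not_not] at hx hy
  rw [hx, hy]

/-- The chain of a walk has Hamming weight at most the number of steps (finite vertex set).
[cite: DennisEtAl2002, §3.1 (the weight of a chain is its number of links)] -/
theorem hammingNorm_wchain_le [Fintype V] (g₁ g₂ : V) (v : V) (w : List Step) :
    hammingNorm (wchain g₁ g₂ v w) ≤ w.length := by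
  induction w generalizing v with
  | nil => simp
  | cons s t ih =>
    rw [wchain_cons, List.length_cons]
    have h1 := hammingNorm_add_le' (Pi.single (s.edge g₁ g₂ v) (1 : ZMod 2) : V ⊕ V → ZMod 2)
      (wchain g₁ g₂ (s.move g₁ g₂ v) t)
    have h2 := hammingNorm_single_le_one (s.edge g₁ g₂ v)
    have h3 := ih (s.move g₁ g₂ v)
    omega

end Walks

/-! ## Staircases -/

section Stair

/-- `|a|` copies of the horizontal step of the sign of `a`. (definition) [cite: KovalevPryadko2012, §III.C (p0005 L72-76: a straight chain realising a period)] -/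
def hsteps (a : ℤ) : List Step :=
  if 0 ≤ a then List.replicate a.natAbs Step.hp else List.replicate a.natAbs Step.hm

/-- `|b|` copies of the vertical step of the sign of `b`. (definition) [cite: KovalevPryadko2012, §III.C (p0005 L72-76)] -/
def vsteps (b : ℤ) : List Step :=
  if 0 ≤ b then List.replicate b.natAbs Step.vp else List.replicate b.natAbs Step.vm

/-- The **staircase walk** of displacement `m`: `|m₁|` horizontal unit steps, then `|m₂|` vertical ones.
(definition) [cite: KovalevPryadko2012, §III.C (p0005 L72-76: the shortest topologically non-trivial chain for a period L)] -/
def stair (m : ℤ × ℤ) : List Step := hsteps m.1 ++ vsteps m.2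

/-- Net displacement of `n` copies of one step. [cite: KovalevPryadko2012, §III.C (p0005 L53-56)] -/
theorem ndisp_replicate (s : Step) (n : ℕ) :
    ndisp (List.replicate n s) = ((n : ℤ) * s.disp.1, (n : ℤ) * s.disp.2) := by
  induction n with
  | zero => simp [ndisp, Prod.ext_iff]
  | succ k ih =>
    rw [List.replicate_succ, ndisp, ih]
    ext <;> simp <;> ring

/-- `ndisp (hsteps a) = (a, 0)`. [cite: KovalevPryadko2012, §III.C (p0005 L72-76)] -/
theorem ndisp_hsteps (a : ℤ) : ndisp (hsteps a) = (a, 0) := by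
  unfold hsteps
  split_ifs with h
  · rw [ndisp_replicate]; have := abs_of_nonneg h; ext <;> simp [Step.disp, this]
  · rw [ndisp_replicate]; have := abs_of_neg (not_le.mp h); ext <;> simp [Step.disp, this]

/-- `ndisp (vsteps b) = (0, b)`. [cite: KovalevPryadko2012, §III.C (p0005 L72-76)] -/
theorem ndisp_vsteps (b : ℤ) : ndisp (vsteps b) = (0, b) := by
  unfold vsteps
  split_ifs with h
  · rw [ndisp_replicate]; have := abs_of_nonneg h; ext <;> simp [Step.disp, this]
  · rw [ndisp_replicate]; have := abs_of_neg (not_le.mp h); ext <;> simp [Step.disp, this]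

/-- **The staircase of `m` has net displacement `m`.** [cite: KovalevPryadko2012, §III.C (p0005 L72-76)] -/
theorem ndisp_stair (m : ℤ × ℤ) : ndisp (stair m) = m := by
  rw [stair, ndisp_append, ndisp_hsteps, ndisp_vsteps]
  ext <;> simp

/-- `length (hsteps a) = |a|`. [cite: KovalevPryadko2012, §III.C (p0005 L72-76)] -/
theorem length_hsteps (a : ℤ) : (hsteps a).length = a.natAbs := by
  unfold hsteps; split_ifs <;> simp

/-- `length (vsteps b) = |b|`. [cite: KovalevPryadko2012, §III.C (p0005 L72-76)] -/
theorem length_vsteps (b : ℤ) : (vsteps b).length = b.natAbs := by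
  unfold vsteps; split_ifs <;> simp

/-- **The staircase of `m` has exactly `l1 m = |m₁| + |m₂|` steps.**
[cite: KovalevPryadko2012, §III.C (p0005 L72-80: the chain realising the period L has ‖L‖ operators)] -/
theorem length_stair (m : ℤ × ℤ) : (stair m).length = l1 m := by
  rw [stair, List.length_append, length_hsteps, length_vsteps, l1]

/-- The staircase of a period `m`, started anywhere, is a CLOSED walk.
[cite: KovalevPryadko2012, §III.C (p0005 L53-56: a lattice period closes up on the torus)] -/
theorem endPos_stair_of_isPeriod {V : Type*} [AddCommGroup V] {g₁ g₂ : V} {m : ℤ × ℤ}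
    (hm : IsPeriod g₁ g₂ m) (v : V) : endPos g₁ g₂ v (stair m) = v := by
  rw [closed_iff_isPeriod, ndisp_stair]; exact hm

end Stair

end TwistedToric

end Literature.InformationTheory.QuantumCodes
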